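import Summits.CriticalPhenomena.PercolationContinuityZ3.Theorems.SahiConjectureProduct
import Summits.CriticalPhenomena.PercolationContinuityZ3.Theorems.PercNearOneGluingNoHeavyLowerTailSahiWidthPhaseDiagram

/-!
# `NoHeavyLowerTail` (crux stmt-CriticalPhenomena-4575), Sahi programme P1: Kahn's Conjecture 5 in the width stratification

Support file (Sahi cell, seat `prim-sahi-p1`, generation 3; `--supports stmt-CriticalPhenomena-4575`).

Kahn's Conjecture 5 [Kahn2022] (third-order positivity `2μ(ABC) − Σμ(AB)μ(C) + μ(A)μ(B)μ(C) ≥ 0` for three increasing events of a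
product measure on a finite cube — the hypothesis under which the tree proves every E3GRP row of the crux programme,
`rowHolds_of_kahnConjecture`) is the order-`3` slice of Sahi's conjecture (`sahiConjecture_three_iff_kahnConjecture`).  In the width
stratification of this programme (`SahiWidth.*`) it therefore reads:

* `kahnConjecture_iff_forall_uniformGrid`: `KahnConjecture ⟺` for every dimension `d` and every `M ≥ 1`, the UNIFORM weight on the box
  `[M]^d` satisfies `E_3 ≥ 0` for all triples of nonnegative monotone functions (`⟺` the counting inequality
  `2N²|ABC| + |A||B||C| ≥ N Σ|A||BC|` for up-sets of every box, `N = M^d`);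
* `kahnConjecture_iff_forall_fkg_grid`: `⟺` `E_3 ≥ 0` for every FKG probability weight on every grid `[b+1]^d`, all `d`;
* the slices `d ≤ 2` are theorems (`uniformGrid_of_dim_le_two`), so (`forall_uniformGrid_three_iff_three_le`) Kahn's conjecture is
  equivalent to its slices `d ≥ 3`, the first of which, `U(3,3)`, is exactly Sahi's `C₃` on the lattices of J-width `≤ 3`
  (`fkg_grid_iff_uniform 3 3`).

New mathematics (the organisation), standard ingredients; nothing open is asserted.
-/

namespace Summit.CriticalPhenomena.PercolationContinuityZ3.Theorems.SahiWidth

open Finset Function Literature.Combinatorics.Sahi2008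
open scoped BigOperators

noncomputable section

/-- **Kahn's Conjecture 5 ⟺ third-order positivity of the uniform weight on every discrete box `[M]^d`.** [this work] -/
theorem kahnConjecture_iff_forall_uniformGrid :
    KahnConjecture ↔ ∀ (d M : ℕ), 0 < M → SahiPositive (fun _ : Fin d → Fin M => (1 : ℝ) / (M : ℝ) ^ d) 3 := by
  rw [← sahiConjecture_three_iff_kahnConjecture]
  exact sahiConjecture_iff_forall_uniformGrid 3

/-- **Kahn's Conjecture 5 ⟺ `E_3 ≥ 0` for every FKG probability weight on every grid `[b+1]^d`** (all dimensions). [this work] -/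
theorem kahnConjecture_iff_forall_fkg_grid :
    KahnConjecture ↔ ∀ (d b : ℕ) (μ : (Fin d → Fin (b + 1)) → ℝ), IsFKGMeasure μ → SahiPositive μ 3 := by
  rw [kahnConjecture_iff_forall_uniformGrid]
  exact ⟨fun h d => (fkg_grid_iff_uniform d 3).1 (h d), fun h d => (fkg_grid_iff_uniform d 3).2 (h d)⟩

/-- The slices `d ≤ 2` being theorems, the family of uniform-box statements at order `3` reduces to its members `d ≥ 3`.
[this work] -/
theorem forall_uniformGrid_three_iff_three_le :
    (∀ (d M : ℕ), 0 < M → SahiPositive (fun _ : Fin d → Fin M => (1 : ℝ) / (M : ℝ) ^ d) 3) ↔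
      ∀ (d M : ℕ), 3 ≤ d → 0 < M → SahiPositive (fun _ : Fin d → Fin M => (1 : ℝ) / (M : ℝ) ^ d) 3 := by
  refine ⟨fun h d M _ hM => h d M hM, fun h d M hM => ?_⟩
  by_cases hd : 3 ≤ d
  · exact h d M hd hM
  · exact uniformGrid_of_dim_le_two (by omega) M hM

/-- **Kahn's Conjecture 5 ⟺ its slices of dimension `≥ 3`**: third-order positivity of the uniform weight on the boxes `[M]^d`,
`d ≥ 3` (the first slice, `d = 3`, is Sahi's `C₃` on the lattices of J-width `≤ 3`, `fkg_grid_iff_uniform 3 3`). [this work] -/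
theorem kahnConjecture_iff_forall_uniformGrid_three_le :
    KahnConjecture ↔ ∀ (d M : ℕ), 3 ≤ d → 0 < M → SahiPositive (fun _ : Fin d → Fin M => (1 : ℝ) / (M : ℝ) ^ d) 3 := by
  rw [kahnConjecture_iff_forall_uniformGrid, forall_uniformGrid_three_iff_three_le]

end

end Summit.CriticalPhenomena.PercolationContinuityZ3.Theorems.SahiWidth
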